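import Literature.NumberTheory.Weil1964.AdelicThetaDistribution
import Literature.MathematicalPhysics.QuantumLattice.SchwartzTensor
import HarnessLib

/-!
# Schwartz–Bruhat functions on a direct sum `𝔸_K^{ι₁ ⊕ ι₂} = 𝔸_K^{ι₁} × 𝔸_K^{ι₂}`: the external tensor `Φ₁ ⊠ Φ₂`
# and the product formula for the theta distribution

Topic `NumberTheory/Automorphic`; namespace `Literature.NumberTheory.Automorphic`.  For a number field `K` and finite
index types `ι₁, ι₂` (think: bases of two `K`-vector spaces `X₁, X₂`, so that `X₁ ⊕ X₂` has basis indexed by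
`ι₁ ⊕ ι₂`):

* `boxTensor Φ₁ Φ₂ : (ι₁ ⊕ ι₂ → 𝔸_K) → ℂ`, `(Φ₁ ⊠ Φ₂)(x) = Φ₁(x ∘ inl) · Φ₂(x ∘ inr)` — the external tensor of two
  functions; bilinear (`boxTensor_add_left/right`, `boxTensor_smul_left/right`);
* **`boxTensor_mem_piSchwartzBruhat`**: `Φ_j ∈ 𝒮(𝔸_K^{ι_j})` ⇒ `Φ₁ ⊠ Φ₂ ∈ 𝒮(𝔸_K^{ι₁ ⊕ ι₂})` (factorizable ⊠
  factorizable is factorizable: the archimedean factor is the tree's product of Schwartz functions in separate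
  variables `SchwartzMap.mulComp`, the finite factor is locally constant with compact support); the bundled bilinear
  map **`tensorToSum K ι₁ ι₂ : 𝒮(𝔸^{ι₁}) →ₗ[ℂ] 𝒮(𝔸^{ι₂}) →ₗ[ℂ] 𝒮(𝔸^{ι₁ ⊕ ι₂})`**;
* rational points split: `ratPt (ι₁ ⊕ ι₂) ξ ∘ inl = ratPt ι₁ (ξ ∘ inl)` (`boxTensor_ratPt` — Weil's
  "`X_k = X_{1,k} × X_{2,k}`"), and **`thetaDist_boxTensor`**:
  `Θ(Φ₁ ⊠ Φ₂) = Θ(Φ₁) · Θ(Φ₂)` for `Φ_j ∈ 𝒮` (absolute convergence + `Σ_{ξ} = Σ_{ξ₁} Σ_{ξ₂}`).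

This is the product-function vocabulary ("(⊗0)") of the Hodge-CM cell's node W2-⊗ (the restriction of the oscillator
representation of `Sp(X₁ ⊕ X₂)` to the see-saw sub-pair is the tensor of the small ones): the PKG hypothesis
`ThetaSeesawData.EvalTmul` is `boxTensor_ratPt`, and the theta-series product [Weil 1964, n° 41] /
`ThetaSeriesProduct.thetaSeries_pair` gets its `hev` from it.  Everything is proved; no named facts.

## References

* A. Weil, *Sur certains groupes d'opérateurs unitaires*, Acta Math. 111 (1964), Chap. III n° 41, Thm 6 p. 193
  (`Θ` on `S(X_A)`; for `X = X₁ ⊕ X₂` the kernels multiply). [Weil1964]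
* J. Tate, in Cassels–Fröhlich, *Algebraic Number Theory* (1967), Ch. XV §3.2 (standard functions). [CasselsFrohlichANT1967]
-/

noncomputable section

open NumberField NumberField.mixedEmbedding IsDedekindDomain Literature.NumberTheory.Weil1964
open scoped SchwartzMap Classical

namespace Literature.NumberTheory.Automorphic

section BoxTensor

variable {K : Type} [Field K] [NumberField K] {ι₁ ι₂ : Type}

/-- **The external tensor** `(Φ₁ ⊠ Φ₂)(x) = Φ₁(x ∘ inl) · Φ₂(x ∘ inr)` of two functions on `𝔸_K^{ι₁}`,
`𝔸_K^{ι₂}`, a function on `𝔸_K^{ι₁ ⊕ ι₂}`. [folklore] -/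
def boxTensor (Φ₁ : (ι₁ → AdeleRing (𝓞 K) K) → ℂ) (Φ₂ : (ι₂ → AdeleRing (𝓞 K) K) → ℂ) :
    (ι₁ ⊕ ι₂ → AdeleRing (𝓞 K) K) → ℂ :=
  fun x => Φ₁ (fun i => x (Sum.inl i)) * Φ₂ (fun j => x (Sum.inr j))

/-- Unfolding. [folklore] -/
theorem boxTensor_apply (Φ₁ : (ι₁ → AdeleRing (𝓞 K) K) → ℂ) (Φ₂ : (ι₂ → AdeleRing (𝓞 K) K) → ℂ)
    (x : ι₁ ⊕ ι₂ → AdeleRing (𝓞 K) K) :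
    boxTensor Φ₁ Φ₂ x = Φ₁ (fun i => x (Sum.inl i)) * Φ₂ (fun j => x (Sum.inr j)) := rfl

/-- On a point assembled from two halves: `(Φ₁ ⊠ Φ₂)(Sum.elim x₁ x₂) = Φ₁ x₁ · Φ₂ x₂`. [folklore] -/
@[simp] theorem boxTensor_elim (Φ₁ : (ι₁ → AdeleRing (𝓞 K) K) → ℂ) (Φ₂ : (ι₂ → AdeleRing (𝓞 K) K) → ℂ)
    (x₁ : ι₁ → AdeleRing (𝓞 K) K) (x₂ : ι₂ → AdeleRing (𝓞 K) K) :
    boxTensor Φ₁ Φ₂ (Sum.elim x₁ x₂) = Φ₁ x₁ * Φ₂ x₂ := rfl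

/-- Additivity in the first factor. [folklore] -/
theorem boxTensor_add_left (Φ₁ Φ₁' : (ι₁ → AdeleRing (𝓞 K) K) → ℂ) (Φ₂ : (ι₂ → AdeleRing (𝓞 K) K) → ℂ) :
    boxTensor (Φ₁ + Φ₁') Φ₂ = boxTensor Φ₁ Φ₂ + boxTensor Φ₁' Φ₂ := by
  funext x; simp [boxTensor, add_mul]

/-- Additivity in the second factor. [folklore] -/
theorem boxTensor_add_right (Φ₁ : (ι₁ → AdeleRing (𝓞 K) K) → ℂ) (Φ₂ Φ₂' : (ι₂ → AdeleRing (𝓞 K) K) → ℂ) :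
    boxTensor Φ₁ (Φ₂ + Φ₂') = boxTensor Φ₁ Φ₂ + boxTensor Φ₁ Φ₂' := by
  funext x; simp [boxTensor, mul_add]

/-- Homogeneity in the first factor. [folklore] -/
theorem boxTensor_smul_left (a : ℂ) (Φ₁ : (ι₁ → AdeleRing (𝓞 K) K) → ℂ) (Φ₂ : (ι₂ → AdeleRing (𝓞 K) K) → ℂ) :
    boxTensor (a • Φ₁) Φ₂ = a • boxTensor Φ₁ Φ₂ := by
  funext x; simp [boxTensor, mul_assoc]

/-- Homogeneity in the second factor. [folklore] -/
theorem boxTensor_smul_right (a : ℂ) (Φ₁ : (ι₁ → AdeleRing (𝓞 K) K) → ℂ) (Φ₂ : (ι₂ → AdeleRing (𝓞 K) K) → ℂ) :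
    boxTensor Φ₁ (a • Φ₂) = a • boxTensor Φ₁ Φ₂ := by
  funext x; simp [boxTensor, mul_left_comm]

/-- `0 ⊠ Φ₂ = 0`. [folklore] -/
@[simp] theorem boxTensor_zero_left (Φ₂ : (ι₂ → AdeleRing (𝓞 K) K) → ℂ) :
    boxTensor (0 : (ι₁ → AdeleRing (𝓞 K) K) → ℂ) Φ₂ = 0 := by
  funext x; simp [boxTensor]

/-- `Φ₁ ⊠ 0 = 0`. [folklore] -/
@[simp] theorem boxTensor_zero_right (Φ₁ : (ι₁ → AdeleRing (𝓞 K) K) → ℂ) :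
    boxTensor Φ₁ (0 : (ι₂ → AdeleRing (𝓞 K) K) → ℂ) = 0 := by
  funext x; simp [boxTensor]

/-! ### Rational points of the direct sum -/

/-- The principal point of `ξ ∈ K^{ι₁ ⊕ ι₂}` restricted to `ι₁` is the principal point of `ξ ∘ inl`
("`X_k = X_{1,k} × X_{2,k}`"). [folklore] -/
theorem ratPt_comp_inl (ξ : ι₁ ⊕ ι₂ → K) :
    (fun i => ratPt K (ι₁ ⊕ ι₂) ξ (Sum.inl i)) = ratPt K ι₁ (fun i => ξ (Sum.inl i)) := rfl

/-- Same for `inr`. [folklore] -/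
theorem ratPt_comp_inr (ξ : ι₁ ⊕ ι₂ → K) :
    (fun j => ratPt K (ι₁ ⊕ ι₂) ξ (Sum.inr j)) = ratPt K ι₂ (fun j => ξ (Sum.inr j)) := rfl

/-- **Pure tensors evaluate as products at rational points** (the PKG hypothesis `ThetaSeesawData.EvalTmul`):
`(Φ₁ ⊠ Φ₂)(ξ) = Φ₁(ξ ∘ inl) · Φ₂(ξ ∘ inr)`. [cite: Weil1964, Chap. III n° 41, Thm 6 p. 193] -/
theorem boxTensor_ratPt (Φ₁ : (ι₁ → AdeleRing (𝓞 K) K) → ℂ) (Φ₂ : (ι₂ → AdeleRing (𝓞 K) K) → ℂ)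
    (ξ : ι₁ ⊕ ι₂ → K) :
    boxTensor Φ₁ Φ₂ (ratPt K (ι₁ ⊕ ι₂) ξ) =
      Φ₁ (ratPt K ι₁ (fun i => ξ (Sum.inl i))) * Φ₂ (ratPt K ι₂ (fun j => ξ (Sum.inr j))) := rfl

/-- The same through the equivalence `K^{ι₁ ⊕ ι₂} ≃ K^{ι₁} × K^{ι₂}`. [folklore] -/
theorem boxTensor_ratPt_elim (Φ₁ : (ι₁ → AdeleRing (𝓞 K) K) → ℂ) (Φ₂ : (ι₂ → AdeleRing (𝓞 K) K) → ℂ)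
    (ξ₁ : ι₁ → K) (ξ₂ : ι₂ → K) :
    boxTensor Φ₁ Φ₂ (ratPt K (ι₁ ⊕ ι₂) (Sum.elim ξ₁ ξ₂)) = Φ₁ (ratPt K ι₁ ξ₁) * Φ₂ (ratPt K ι₂ ξ₂) := rfl

/-- The archimedean coordinates of `x` restricted to `ι₁` are those of `x ∘ inl` (coordinatewise definition).
[folklore] -/
theorem piArch_comp_inl (x : ι₁ ⊕ ι₂ → AdeleRing (𝓞 K) K) :
    (fun i => piArch K (ι₁ ⊕ ι₂) x (Sum.inl i)) = piArch K ι₁ (fun i => x (Sum.inl i)) := rfl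

/-- Same for `inr`. [folklore] -/
theorem piArch_comp_inr (x : ι₁ ⊕ ι₂ → AdeleRing (𝓞 K) K) :
    (fun j => piArch K (ι₁ ⊕ ι₂) x (Sum.inr j)) = piArch K ι₂ (fun j => x (Sum.inr j)) := rfl

end BoxTensor

/-! ### `Φ₁ ⊠ Φ₂` is a Schwartz–Bruhat function -/

section Membership

variable {K : Type} [Field K] [NumberField K] {ι₁ ι₂ : Type} [Fintype ι₁] [Fintype ι₂]

/-- The product of two Schwartz functions in separate variables on `(K ⊗ ℝ)^{ι₁ ⊕ ι₂}` (tree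
`SchwartzMap.mulComp` along the two coordinate restrictions, which jointly control the sup norm). [folklore] -/
def archBoxTensor (f : 𝓢((ι₁ → mixedSpace K), ℂ)) (g : 𝓢((ι₂ → mixedSpace K), ℂ)) :
    𝓢((ι₁ ⊕ ι₂ → mixedSpace K), ℂ) :=
  SchwartzMap.mulComp f g (SchwartzMap.restrictCLM Sum.inl) (SchwartzMap.restrictCLM Sum.inr) ⟨1, fun x => by
    rw [one_mul, pi_norm_le_iff_of_nonneg (by positivity)]
    rintro (i | j)
    · exact (norm_le_pi_norm (x ∘ Sum.inl) i).trans (le_max_left _ _)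
    · exact (norm_le_pi_norm (x ∘ Sum.inr) j).trans (le_max_right _ _)⟩

/-- Pointwise formula. [folklore] -/
@[simp] theorem archBoxTensor_apply (f : 𝓢((ι₁ → mixedSpace K), ℂ))
    (g : 𝓢((ι₂ → mixedSpace K), ℂ)) (x : ι₁ ⊕ ι₂ → mixedSpace K) :
    archBoxTensor f g x = f (x ∘ Sum.inl) * g (x ∘ Sum.inr) := rfl

omit [Fintype ι₁] [Fintype ι₂] in
/-- The product of two locally constant compactly supported functions in separate variables on
`(𝔸_K^∞)^{ι₁ ⊕ ι₂}` is locally constant with compact support. [folklore] -/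
theorem finBoxTensor_mem_schwartzBruhat {f : (ι₁ → FiniteAdeleRing (𝓞 K) K) → ℂ}
    {g : (ι₂ → FiniteAdeleRing (𝓞 K) K) → ℂ} (hf : f ∈ SchwartzBruhat (ι₁ → FiniteAdeleRing (𝓞 K) K))
    (hg : g ∈ SchwartzBruhat (ι₂ → FiniteAdeleRing (𝓞 K) K)) :
    (fun y : ι₁ ⊕ ι₂ → FiniteAdeleRing (𝓞 K) K => f (fun i => y (Sum.inl i)) * g (fun j => y (Sum.inr j))) ∈
      SchwartzBruhat (ι₁ ⊕ ι₂ → FiniteAdeleRing (𝓞 K) K) := by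
  rw [mem_schwartzBruhat_iff] at hf hg ⊢
  have h₁ : Continuous fun y : ι₁ ⊕ ι₂ → FiniteAdeleRing (𝓞 K) K => fun i => y (Sum.inl i) :=
    continuous_pi fun i => continuous_apply _
  have h₂ : Continuous fun y : ι₁ ⊕ ι₂ → FiniteAdeleRing (𝓞 K) K => fun j => y (Sum.inr j) :=
    continuous_pi fun j => continuous_apply _
  refine ⟨(hf.1.comp_continuous h₁).mul (hg.1.comp_continuous h₂), ?_⟩
  -- support inside the image of `tsupport f × tsupport g` under `Sum.elim`
  have hc : IsCompact ((fun p : (ι₁ → FiniteAdeleRing (𝓞 K) K) × (ι₂ → FiniteAdeleRing (𝓞 K) K) =>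
      Sum.elim p.1 p.2) '' (tsupport f ×ˢ tsupport g)) := by
    refine (hf.2.prod hg.2).image ?_
    exact continuous_pi fun i => by
      rcases i with i | j
      · exact (continuous_apply i).comp continuous_fst
      · exact (continuous_apply j).comp continuous_snd
  refine HasCompactSupport.intro hc fun y hy => ?_
  by_contra hne
  apply hy
  refine ⟨(fun i => y (Sum.inl i), fun j => y (Sum.inr j)), ⟨?_, ?_⟩, ?_⟩
  · exact subset_tsupport _ (left_ne_zero_of_mul hne)
  · exact subset_tsupport _ (right_ne_zero_of_mul hne)
  · funext i; rcases i with i | j <;> rfl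

/-- **Factorizable ⊠ factorizable is factorizable.** [folklore] -/
theorem isFactorizablePiSchwartzBruhat_boxTensor {Φ₁ : (ι₁ → AdeleRing (𝓞 K) K) → ℂ}
    {Φ₂ : (ι₂ → AdeleRing (𝓞 K) K) → ℂ} (h₁ : IsFactorizablePiSchwartzBruhat K ι₁ Φ₁)
    (h₂ : IsFactorizablePiSchwartzBruhat K ι₂ Φ₂) :
    IsFactorizablePiSchwartzBruhat K (ι₁ ⊕ ι₂) (boxTensor Φ₁ Φ₂) := by
  obtain ⟨f₁, g₁, hg₁, rfl⟩ := h₁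
  obtain ⟨f₂, g₂, hg₂, rfl⟩ := h₂
  refine ⟨archBoxTensor f₁ f₂, fun y => g₁ (fun i => y (Sum.inl i)) * g₂ (fun j => y (Sum.inr j)),
    finBoxTensor_mem_schwartzBruhat hg₁ hg₂, ?_⟩
  funext x
  rw [boxTensor_apply, archBoxTensor_apply]
  have e₁ : (piArch K (ι₁ ⊕ ι₂) x ∘ Sum.inl) = piArch K ι₁ (fun i => x (Sum.inl i)) := rfl
  have e₂ : (piArch K (ι₁ ⊕ ι₂) x ∘ Sum.inr) = piArch K ι₂ (fun j => x (Sum.inr j)) := rfl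
  rw [e₁, e₂]
  show _ = _ * (g₁ (piFinite K ι₁ fun i => x (Sum.inl i)) * g₂ (piFinite K ι₂ fun j => x (Sum.inr j)))
  ring

/-- **`Φ₁ ⊠ Φ₂ ∈ 𝒮(𝔸_K^{ι₁ ⊕ ι₂})`** for `Φ_j ∈ 𝒮(𝔸_K^{ι_j})` (span induction in both factors). [folklore] -/
theorem boxTensor_mem_piSchwartzBruhat {Φ₁ : (ι₁ → AdeleRing (𝓞 K) K) → ℂ}
    {Φ₂ : (ι₂ → AdeleRing (𝓞 K) K) → ℂ} (h₁ : Φ₁ ∈ piSchwartzBruhat K ι₁) (h₂ : Φ₂ ∈ piSchwartzBruhat K ι₂) :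
    boxTensor Φ₁ Φ₂ ∈ piSchwartzBruhat K (ι₁ ⊕ ι₂) := by
  induction h₂ using Submodule.span_induction with
  | mem Ψ₂ hΨ₂ =>
    induction h₁ using Submodule.span_induction with
    | mem Ψ₁ hΨ₁ => exact mem_piSchwartzBruhat (isFactorizablePiSchwartzBruhat_boxTensor hΨ₁ hΨ₂)
    | zero => rw [boxTensor_zero_left]; exact Submodule.zero_mem _
    | add Ψ Ψ' _ _ hΨ hΨ' => rw [boxTensor_add_left]; exact Submodule.add_mem _ hΨ hΨ'
    | smul a Ψ _ hΨ => rw [boxTensor_smul_left]; exact Submodule.smul_mem _ a hΨ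
  | zero => rw [boxTensor_zero_right]; exact Submodule.zero_mem _
  | add Ψ Ψ' _ _ hΨ hΨ' => rw [boxTensor_add_right]; exact Submodule.add_mem _ hΨ hΨ'
  | smul a Ψ _ hΨ => rw [boxTensor_smul_right]; exact Submodule.smul_mem _ a hΨ

variable (K ι₁ ι₂)

/-- **The tensor map `𝒮(𝔸^{ι₁}) × 𝒮(𝔸^{ι₂}) → 𝒮(𝔸^{ι₁ ⊕ ι₂})`**, bilinear. [folklore] -/
def tensorToSum : piSchwartzBruhat K ι₁ →ₗ[ℂ] piSchwartzBruhat K ι₂ →ₗ[ℂ] piSchwartzBruhat K (ι₁ ⊕ ι₂) :=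
  LinearMap.mk₂ ℂ
    (fun Φ₁ Φ₂ => ⟨boxTensor (Φ₁ : (ι₁ → AdeleRing (𝓞 K) K) → ℂ) (Φ₂ : (ι₂ → AdeleRing (𝓞 K) K) → ℂ),
      boxTensor_mem_piSchwartzBruhat Φ₁.2 Φ₂.2⟩)
    (fun _ _ _ => Subtype.ext (boxTensor_add_left _ _ _))
    (fun _ _ _ => Subtype.ext (boxTensor_smul_left _ _ _))
    (fun _ _ _ => Subtype.ext (boxTensor_add_right _ _ _))
    (fun _ _ _ => Subtype.ext (boxTensor_smul_right _ _ _))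

variable {K ι₁ ι₂}

/-- Values of `tensorToSum`. [folklore] -/
@[simp] theorem coe_tensorToSum (Φ₁ : piSchwartzBruhat K ι₁) (Φ₂ : piSchwartzBruhat K ι₂) :
    ((tensorToSum K ι₁ ι₂ Φ₁ Φ₂ : piSchwartzBruhat K (ι₁ ⊕ ι₂)) : (ι₁ ⊕ ι₂ → AdeleRing (𝓞 K) K) → ℂ) =
      boxTensor (Φ₁ : (ι₁ → AdeleRing (𝓞 K) K) → ℂ) (Φ₂ : (ι₂ → AdeleRing (𝓞 K) K) → ℂ) := rfl

end Membership

/-! ### The theta distribution of a pure tensor -/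

section Theta

variable {K : Type} [Field K] [NumberField K] {ι₁ ι₂ : Type} [Fintype ι₁] [Fintype ι₂]

/-- **`Θ(Φ₁ ⊠ Φ₂) = Θ(Φ₁) · Θ(Φ₂)`** for Schwartz–Bruhat `Φ₁, Φ₂`: the sum over `K^{ι₁ ⊕ ι₂} = K^{ι₁} × K^{ι₂}` of
the products is the product of the (absolutely convergent) sums. [cite: Weil1964, Chap. III n° 41, Thm 6 p. 193] -/
theorem thetaDist_boxTensor {Φ₁ : (ι₁ → AdeleRing (𝓞 K) K) → ℂ} {Φ₂ : (ι₂ → AdeleRing (𝓞 K) K) → ℂ}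
    (h₁ : Φ₁ ∈ piSchwartzBruhat K ι₁) (h₂ : Φ₂ ∈ piSchwartzBruhat K ι₂) :
    thetaDist K (ι₁ ⊕ ι₂) (boxTensor Φ₁ Φ₂) = thetaDist K ι₁ Φ₁ * thetaDist K ι₂ Φ₂ := by
  rw [thetaDist_def, thetaDist_def, thetaDist_def,
    tsum_mul_tsum_of_summable_norm (summable_norm_ratPt h₁) (summable_norm_ratPt h₂),
    ← (Equiv.sumArrowEquivProdArrow ι₁ ι₂ K).symm.tsum_eq]
  refine tsum_congr fun p => ?_
  rcases p with ⟨ξ₁, ξ₂⟩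
  show boxTensor Φ₁ Φ₂ (ratPt K (ι₁ ⊕ ι₂) (Sum.elim ξ₁ ξ₂)) = _
  exact boxTensor_ratPt_elim Φ₁ Φ₂ ξ₁ ξ₂

/-- The same for the bundled `tensorToSum` / `thetaDistLM`. [folklore] -/
theorem thetaDistLM_tensorToSum (Φ₁ : piSchwartzBruhat K ι₁) (Φ₂ : piSchwartzBruhat K ι₂) :
    thetaDistLM K (ι₁ ⊕ ι₂) (tensorToSum K ι₁ ι₂ Φ₁ Φ₂) = thetaDistLM K ι₁ Φ₁ * thetaDistLM K ι₂ Φ₂ := by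
  simp only [thetaDistLM_apply, coe_tensorToSum]
  exact thetaDist_boxTensor Φ₁.2 Φ₂.2

end Theta

end Literature.NumberTheory.Automorphic

end
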